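import Mathlib.Combinatorics.SimpleGraph.Basic
import Mathlib.Data.Set.Card
import Mathlib.Data.List.Infix
import Mathlib.Data.List.Permutation
import Mathlib.Data.Set.Finite.List
import HarnessLib

/-!
# Counting Hamiltonian paths by their vertex lists, with required and forbidden edges

Combinatorial support for gadget reductions to Hamiltonian-path counting problems (the method of
"local replacement" of Garey–Johnson 1979, §3.2.2, as used for `#P`-completeness of counting
Hamiltonian paths in planar graphs of maximum degree three by Garey–Johnson–Tarjan 1976 and
Liśkiewicz–Ogihara–Toda 2003, Lemma 4). A Hamiltonian `s`–`t` path of a simple graph `G` through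
a finite vertex set `V` is recorded by its VERTEX LIST (the convention of the counting problem
`Literature.Barriers.CriticalPhenomena.GridSAW.hamPathCount`, and the support of a Mathlib
`SimpleGraph.Walk` that `IsHamiltonian`):

* `IsHamPathOn G V s t l` — `l` lists the vertices of `V` once each, from `s` to `t`, consecutive
  vertices adjacent in `G`;
* `Uses l e` — the path uses the edge `{e.1, e.2}` (the two vertices are consecutive in `l`);
* `hamSetRF G V s t R F`, `hamCountRF G V s t R F` — the Hamiltonian `s`–`t` paths using every
  edge of `R` (required) and no edge of `F` (forbidden), and their number (a finite set,
  `hamSetRF_finite`); `hamCount G V s t` is the unconstrained count.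

Proved: finiteness, elementary consequences (end points and used edges lie in `V` and `G`),
invariance under reversal (`hamCountRF_reverse`), transport of paths along an injective
relabelling of the vertices (`IsHamPathOn.map`), and the decision instances used for sanity checks. The gadget
substitution theorem built on these notions is in `HamiltonianGadgetSubstitution.lean`.

## References

* M. R. Garey, D. S. Johnson, *Computers and Intractability*, Freeman 1979, §3.2.2 (local
  replacement).
* M. R. Garey, D. S. Johnson, R. E. Tarjan, *The planar Hamiltonian circuit problem is
  NP-complete*, SIAM J. Comput. 5 (1976) 704–714.
* M. Liśkiewicz, M. Ogihara, S. Toda, TCS 304 (2003) 129–156, §2.3 (#HamPath), §3.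
-/

namespace Literature.Combinatorics.SimpleGraph

variable {α β : Type*} [DecidableEq α] [DecidableEq β]

/-! ### Hamiltonian paths as vertex lists -/

/-- **A Hamiltonian `s`–`t` path of `G` through the vertex set `V`, as its vertex list**: the
vertices of `V`, each exactly once, from `s` to `t`, consecutive vertices adjacent.
[cite: LiskiewiczOgiharaToda2003, §2.3 (Hamiltonian Path, #HamPath)] -/
def IsHamPathOn (G : _root_.SimpleGraph α) (V : Finset α) (s t : α) (l : List α) : Prop :=
  l.Nodup ∧ l.toFinset = V ∧ l.head? = some s ∧ l.getLast? = some t ∧ List.IsChain G.Adj l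

/-- **The path with vertex list `l` uses the edge `{p, q}`**: `p, q` are consecutive in `l` (in
either order). [folklore] -/
def Uses (l : List α) (e : α × α) : Prop :=
  [e.1, e.2] <:+: l ∨ [e.2, e.1] <:+: l

/-- The Hamiltonian `s`–`t` paths through `V` using every edge of `R` and no edge of `F`.
[cite: GareyJohnson1979, §3.2.2 (local replacement)] -/
def hamSetRF (G : _root_.SimpleGraph α) (V : Finset α) (s t : α) (R F : Finset (α × α)) :
    Set (List α) :=
  {l | IsHamPathOn G V s t l ∧ (∀ e ∈ R, Uses l e) ∧ ∀ e ∈ F, ¬ Uses l e}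

/-- **The number of Hamiltonian `s`–`t` paths through `V` using every edge of `R` and no edge of
`F`.** [cite: GareyJohnson1979, §3.2.2 (local replacement)] -/
noncomputable def hamCountRF (G : _root_.SimpleGraph α) (V : Finset α) (s t : α)
    (R F : Finset (α × α)) : ℕ :=
  (hamSetRF G V s t R F).ncard

/-- **The number of Hamiltonian `s`–`t` paths through `V`** (`#HamPath`).
[cite: LiskiewiczOgiharaToda2003, §2.3 (#HamPath)] -/
noncomputable def hamCount (G : _root_.SimpleGraph α) (V : Finset α) (s t : α) : ℕ :=
  hamCountRF G V s t ∅ ∅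

/-- Decidability of `IsHamPathOn` (for sanity checks on small graphs). [folklore] -/
instance (G : _root_.SimpleGraph α) [DecidableRel G.Adj] (V : Finset α) (s t : α) (l : List α) :
    Decidable (IsHamPathOn G V s t l) := by
  unfold IsHamPathOn; infer_instance

/-- Decidability of `Uses`. [folklore] -/
instance (l : List α) (e : α × α) : Decidable (Uses l e) := by
  unfold Uses; infer_instance

/-! ### Finiteness -/

/-- A list with distinct entries and prescribed support is a permutation of the support.
[folklore] -/
theorem perm_toList_of_nodup_toFinset_eq {l : List α} {V : Finset α} (hnd : l.Nodup)
    (hV : l.toFinset = V) : l.Perm V.toList :=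
  List.perm_of_nodup_nodup_toFinset_eq hnd (Finset.nodup_toList V) (by rw [hV, Finset.toList_toFinset])

/-- The lists with distinct entries and support `V` form a finite set. [folklore] -/
theorem finite_nodup_toFinset_eq (V : Finset α) : {l : List α | l.Nodup ∧ l.toFinset = V}.Finite :=
  (V.toList.permutations.finite_toSet).subset fun _ h =>
    List.mem_permutations.2 (perm_toList_of_nodup_toFinset_eq h.1 h.2)

/-- The constrained Hamiltonian paths form a finite set (so `hamCountRF` is an honest
cardinality). [folklore] -/
theorem hamSetRF_finite (G : _root_.SimpleGraph α) (V : Finset α) (s t : α) (R F : Finset (α × α)) :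
    (hamSetRF G V s t R F).Finite :=
  (finite_nodup_toFinset_eq V).subset fun _ h => ⟨h.1.1, h.1.2.1⟩

/-- The unconstrained count is the count with empty constraints. [folklore] -/
theorem hamCount_eq (G : _root_.SimpleGraph α) (V : Finset α) (s t : α) :
    hamCount G V s t = hamCountRF G V s t ∅ ∅ := rfl

/-- With empty constraints the constrained set is the set of all Hamiltonian paths. [folklore] -/
theorem mem_hamSetRF_empty {G : _root_.SimpleGraph α} {V : Finset α} {s t : α} {l : List α} :
    l ∈ hamSetRF G V s t ∅ ∅ ↔ IsHamPathOn G V s t l := by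
  simp [hamSetRF]

/-- Enlarging the constraints shrinks the set. [folklore] -/
theorem hamSetRF_mono {G : _root_.SimpleGraph α} {V : Finset α} {s t : α} {R R' F F' : Finset (α × α)}
    (hR : R ⊆ R') (hF : F ⊆ F') : hamSetRF G V s t R' F' ⊆ hamSetRF G V s t R F :=
  fun _ h => ⟨h.1, fun e he => h.2.1 e (hR he), fun e he => h.2.2 e (hF he)⟩

/-! ### Used edges -/

omit [DecidableEq α] in
/-- An infix `[p, q]` through indices. [folklore] -/
theorem pair_infix_iff {l : List α} {p q : α} :
    [p, q] <:+: l ↔ ∃ i : ℕ, ∃ _ : i + 1 < l.length, l[i] = p ∧ l[i + 1] = q := by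
  rw [List.infix_iff_getElem?]
  simp only [List.length_cons, List.length_nil, zero_add]
  constructor
  · rintro ⟨k, hk, h⟩
    have h0 := h 0 (by omega)
    have h1 := h 1 (by omega)
    simp only [zero_add, List.getElem_cons_zero, List.getElem_cons_succ] at h0 h1
    obtain ⟨_, h0⟩ := List.getElem?_eq_some_iff.1 h0
    obtain ⟨_, h1⟩ := List.getElem?_eq_some_iff.1 h1
    refine ⟨k, by omega, h0, ?_⟩
    have : 1 + k = k + 1 := by omega
    simp only [this] at h1
    exact h1
  · rintro ⟨i, hi, hp, hq⟩
    refine ⟨i, by omega, fun j hj => ?_⟩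
    have hj2 : j = 0 ∨ j = 1 := by omega
    rcases hj2 with rfl | rfl
    · simpa using List.getElem?_eq_some_iff.2 ⟨by omega, hp⟩
    · have : 1 + i = i + 1 := by omega
      simpa [this] using List.getElem?_eq_some_iff.2 ⟨by omega, hq⟩

omit [DecidableEq α] in
/-- `Uses` through indices: some two consecutive entries are the end points. [folklore] -/
theorem uses_iff_exists_getElem {l : List α} {e : α × α} :
    Uses l e ↔ ∃ i : ℕ, ∃ _ : i + 1 < l.length,
      (l[i] = e.1 ∧ l[i + 1] = e.2) ∨ (l[i] = e.2 ∧ l[i + 1] = e.1) := by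
  unfold Uses
  rw [pair_infix_iff, pair_infix_iff]
  constructor
  · rintro (⟨i, hi, h⟩ | ⟨i, hi, h⟩)
    exacts [⟨i, hi, Or.inl h⟩, ⟨i, hi, Or.inr h⟩]
  · rintro ⟨i, hi, h | h⟩
    exacts [Or.inl ⟨i, hi, h⟩, Or.inr ⟨i, hi, h⟩]

omit [DecidableEq α] in
/-- `Uses` is symmetric in the end points. [folklore] -/
theorem uses_swap {l : List α} {p q : α} : Uses l (p, q) ↔ Uses l (q, p) := by
  unfold Uses; exact Or.comm

omit [DecidableEq α] in
/-- The end points of a used edge lie on the path. [folklore] -/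
theorem Uses.mem {l : List α} {e : α × α} (h : Uses l e) : e.1 ∈ l ∧ e.2 ∈ l := by
  rcases h with h | h
  · exact ⟨h.subset (by simp), h.subset (by simp)⟩
  · exact ⟨h.subset (by simp), h.subset (by simp)⟩

omit [DecidableEq α] in
/-- A used edge of a chain is a related pair. [folklore] -/
theorem Uses.rel_of_isChain {R : α → α → Prop} (hR : ∀ a b, R a b → R b a) {l : List α}
    (hl : List.IsChain R l) {e : α × α} (h : Uses l e) : R e.1 e.2 := by
  rcases h with h | h
  · have := hl.infix h
    simpa using this
  · have := hl.infix h
    simp only [List.isChain_cons_cons, List.isChain_singleton, and_true] at this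
    exact hR _ _ this

omit [DecidableEq α] in
/-- Reversal does not change the used edges. [folklore] -/
theorem uses_reverse {l : List α} {e : α × α} : Uses l.reverse e ↔ Uses l e := by
  have h1 : [e.1, e.2] <:+: l.reverse ↔ [e.2, e.1] <:+: l := by
    rw [show [e.1, e.2] = [e.2, e.1].reverse from rfl, List.reverse_infix]
  have h2 : [e.2, e.1] <:+: l.reverse ↔ [e.1, e.2] <:+: l := by
    rw [show [e.2, e.1] = [e.1, e.2].reverse from rfl, List.reverse_infix]
  unfold Uses
  rw [h1, h2]
  exact Or.comm

omit [DecidableEq α] in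
/-- In a list with distinct entries, if `p` is immediately followed by `q` then `q` is not
immediately followed by `p`. [folklore] -/
theorem not_infix_swap_of_nodup {l : List α} (hl : l.Nodup) {p q : α} (h : [p, q] <:+: l) :
    ¬ [q, p] <:+: l := by
  intro h'
  obtain ⟨i, hi, hp, hq⟩ := pair_infix_iff.1 h
  obtain ⟨j, hj, hq', hp'⟩ := pair_infix_iff.1 h'
  have h1 : i = j + 1 := hl.getElem_inj_iff.1 (hp.trans hp'.symm)
  have h2 : i + 1 = j := hl.getElem_inj_iff.1 (hq.trans hq'.symm)
  omega

/-! ### Elementary properties of Hamiltonian paths -/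

namespace IsHamPathOn

variable {G : _root_.SimpleGraph α} {V : Finset α} {s t : α} {l : List α}

/-- The vertex list is not empty. [folklore] -/
theorem ne_nil (h : IsHamPathOn G V s t l) : l ≠ [] := by
  rintro rfl
  simp [IsHamPathOn] at h

/-- A vertex is on the path iff it is in `V`. [folklore] -/
theorem mem_iff (h : IsHamPathOn G V s t l) {x : α} : x ∈ l ↔ x ∈ V := by
  rw [← h.2.1, List.mem_toFinset]

/-- The path has `|V|` vertices. [folklore] -/
theorem length_eq (h : IsHamPathOn G V s t l) : l.length = V.card := by
  rw [← h.2.1, List.toFinset_card_of_nodup h.1]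

/-- The start point is in `V`. [folklore] -/
theorem start_mem (h : IsHamPathOn G V s t l) : s ∈ V :=
  h.mem_iff.1 (List.mem_of_mem_head? h.2.2.1)

/-- The end point is in `V`. [folklore] -/
theorem end_mem (h : IsHamPathOn G V s t l) : t ∈ V :=
  h.mem_iff.1 (List.mem_of_getLast? h.2.2.2.1)

/-- A used edge is an edge of `G`. [folklore] -/
theorem adj_of_uses (h : IsHamPathOn G V s t l) {e : α × α} (he : Uses l e) : G.Adj e.1 e.2 :=
  he.rel_of_isChain (fun _ _ h => h.symm) h.2.2.2.2

/-- The end points of a used edge are in `V`. [folklore] -/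
theorem mem_of_uses (h : IsHamPathOn G V s t l) {e : α × α} (he : Uses l e) : e.1 ∈ V ∧ e.2 ∈ V :=
  ⟨h.mem_iff.1 he.mem.1, h.mem_iff.1 he.mem.2⟩

/-- **Reversal**: a Hamiltonian `s`–`t` path read backwards is a Hamiltonian `t`–`s` path.
[folklore] -/
theorem reverse (h : IsHamPathOn G V s t l) : IsHamPathOn G V t s l.reverse := by
  obtain ⟨hnd, hV, hs, ht, hc⟩ := h
  refine ⟨List.nodup_reverse.2 hnd, by rw [List.toFinset_reverse, hV], ?_, ?_, ?_⟩
  · rw [List.head?_reverse, ht]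
  · rw [List.getLast?_reverse, hs]
  · exact List.isChain_reverse.2 (hc.imp fun a b h => h.symm)

/-- Changing the graph off the vertex set, or to a graph with the same edges on it, keeps
Hamiltonian paths: only adjacency between vertices of `V` matters. [folklore] -/
theorem mono {G' : _root_.SimpleGraph α} (h : IsHamPathOn G V s t l)
    (hGG' : ∀ a ∈ V, ∀ b ∈ V, G.Adj a b → G'.Adj a b) : IsHamPathOn G' V s t l := by
  refine ⟨h.1, h.2.1, h.2.2.1, h.2.2.2.1, ?_⟩
  rw [List.isChain_iff_forall_rel_of_append_cons_cons]
  intro a b l₁ l₂ hl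
  have hab : G.Adj a b := by
    have := h.2.2.2.2
    rw [List.isChain_iff_forall_rel_of_append_cons_cons] at this
    exact this hl
  refine hGG' a (h.mem_iff.1 ?_) b (h.mem_iff.1 ?_) hab
  · rw [hl]; simp
  · rw [hl]; simp

end IsHamPathOn

/-- A one-vertex path. [folklore] -/
theorem isHamPathOn_singleton (G : _root_.SimpleGraph α) (s : α) : IsHamPathOn G {s} s s [s] := by
  simp [IsHamPathOn]

/-! ### Reversal and relabelling invariance of the counts -/

/-- **Reversal invariance**: as many constrained Hamiltonian `s`–`t` paths as `t`–`s` paths.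
[folklore] -/
theorem hamCountRF_reverse (G : _root_.SimpleGraph α) (V : Finset α) (s t : α) (R F : Finset (α × α)) :
    hamCountRF G V s t R F = hamCountRF G V t s R F := by
  unfold hamCountRF
  have himage : hamSetRF G V t s R F = List.reverse '' hamSetRF G V s t R F := by
    ext l
    constructor
    · intro h
      refine ⟨l.reverse, ⟨h.1.reverse, fun e he => uses_reverse.2 (h.2.1 e he),
        fun e he hu => h.2.2 e he (uses_reverse.1 hu)⟩, List.reverse_reverse l⟩
    · rintro ⟨l', h, rfl⟩
      exact ⟨h.1.reverse, fun e he => uses_reverse.2 (h.2.1 e he),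
        fun e he hu => h.2.2 e he (uses_reverse.1 hu)⟩
  rw [himage, Set.ncard_image_of_injective _ List.reverse_injective]

omit [DecidableEq α] [DecidableEq β] in
/-- Relabelling a list along an injection keeps `Uses` (edges relabelled accordingly). [folklore] -/
theorem uses_map_iff {f : α → β} (hf : Function.Injective f) {l : List α} {e : α × α} :
    Uses (l.map f) (f e.1, f e.2) ↔ Uses l e := by
  simp only [uses_iff_exists_getElem, List.length_map, List.getElem_map, hf.eq_iff]

/-- **Relabelling**: an injective map of the vertices carries Hamiltonian paths of `G` through `V`
to Hamiltonian paths of the pushed-forward graph through the image. [folklore] -/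
theorem IsHamPathOn.map {f : α → β} (hf : Function.Injective f) {G : _root_.SimpleGraph α}
    {G' : _root_.SimpleGraph β} (hG : ∀ a b, G.Adj a b → G'.Adj (f a) (f b))
    {V : Finset α} {s t : α} {l : List α} (h : IsHamPathOn G V s t l) :
    IsHamPathOn G' (V.image f) (f s) (f t) (l.map f) := by
  obtain ⟨hnd, hV, hs, ht, hc⟩ := h
  have himg : (l.map f).toFinset = V.image f := by
    ext b
    simp [← hV, List.mem_toFinset, Finset.mem_image]
  refine ⟨hnd.map hf, himg, by rw [List.head?_map, hs]; rfl,
    by rw [List.getLast?_map, ht]; rfl, ?_⟩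
  exact List.isChain_map f |>.2 (hc.imp fun a b hab => hG a b hab)

end Literature.Combinatorics.SimpleGraph
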